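import Mathlib
import Summits.Ventures.PercRepro2.Defs
import Summits.Ventures.PercRepro2.Graph
import Summits.Ventures.PercRepro2.OneColourSwitch
import Summits.Ventures.PercRepro2.RegionHubSign
import Summits.Ventures.PercRepro2.SideSwitch
import Summits.Ventures.PercRepro2.TermSwitchDefs
import Summits.Ventures.PercRepro2.M9NoPocketDefs
import Summits.Ventures.PercRepro2.M9PsiOneDefs
import Summits.Ventures.PercRepro2.M9PsiOneWorlds
import Summits.Ventures.PercRepro2.M9PsiOneWorldsM
import Summits.Ventures.PercRepro2.M9PsiOneSurvive
import Summits.Ventures.PercRepro2.M9PsiOneLink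

/-!
# `Ψ₁` is injective on the doubly-reached colourings without a `W`-link (blind cell PercRepro2,
p3 g31, 2026-08-28; `proofs/P3-PAYMENT.md` §2, claim (iv))

The source `ω` is recovered from the image `ω' = Ψ₁ ω` (`recPsi`): the edges touching the
joined `Y`-blocks of `ω'` read through `d`'s OPEN edges (`joinedYOpen`) or a linking vertex of
`ω'`, and the closed non-loop edges at `d`, are the kept edges — because the joined `Y`-blocks
and the linking vertices of `ω'` are those of `ω` (`joinedYOpen_psiOne`, `linkSetY_psiOne`:
the blocks of `ω` are kept whole, the flipped `W`-blocks are not linking in `ω'` since `ω` has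
no `W`-link) and `d`'s closed edges of `ω'` are its edges into the joined `W`-blocks of `ω`
(`psiOne_d_closed_iff`).  Hence `recPsi (Ψ₁ ω) = ω` (`recPsi_psiOne`) and `Ψ₁` is injective on
`{ω | IsEX ω ∧ r ≁_W s}` (`psiOne_injOn`).  Own work; std axioms.
-/

namespace Summit.Ventures.PercRepro2

namespace NoPocket

open Finset Classical RegionHub OneColourSwitch SideSwitch TermSwitch

variable {V : Type*} {E : Type*}

section Rec

variable (ends : E → Sym2 V) (r s d : V)

/-- The joined `Y`-blocks of a colouring read through the OPEN edges at `d`. -/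
def joinedYOpen (ω : Config E) : Set V :=
  expl ends {y | y ∈ Kcore ends r s d ω ∧ ∃ e, ends e = s(d, y) ∧ ω e = true}
    (allIn ends (Kcore ends r s d ω))

/-- The edges read as kept from an image: touching a joined (open-read) `Y`-block or a linking
vertex, or a closed non-loop edge at `d`. -/
def recEdges (ω : Config E) : Set E :=
  touches ends (joinedYOpen ends r s d ω ∪ linkSetY ends r s d ω) ∪
    {e | ∃ y, y ≠ d ∧ ends e = s(d, y) ∧ ω e = false}

/-- The recovery map: keep the read-as-kept edges, flip the rest. -/
noncomputable def recPsi (ω : Config E) : Config E :=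
  fun e => if e ∈ recEdges ends r s d ω then ω e else !ω e

end Rec

section Transfer

variable {ends : E → Sym2 V}

/-- All-edge connectivity transfers between vertex sets along a closed subset of both. -/
lemma conn_allIn_transfer {S₁ S₂ T : Set V} {x y : V} (hT : T ⊆ S₂)
    (hcl : ∀ a ∈ T, ∀ b, (openGraph ends (allIn ends S₁)).Adj a b → b ∈ T) (hx : x ∈ T)
    (hc : Conn ends (allIn ends S₁) x y) : Conn ends (allIn ends S₂) x y := by
  have key : y ∈ {z | z ∈ T ∧ Conn ends (allIn ends S₂) x z} := by
    refine mem_of_conn_of_closed (ends := ends) (ω := allIn ends S₁) ?_ ⟨hx, conn_refl _ _ _⟩ hc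
    rintro a ⟨haT, hac⟩ b hab
    have hbT : b ∈ T := hcl a haT b hab
    obtain ⟨_, e, _, hends⟩ := openGraph_adj.1 hab
    exact ⟨hbT, conn_trans hac (conn_allIn_of_edge (hT haT) (hT hbT) hends)⟩
  exact key.2

/-- Restricted connectivity transfers between two colourings agreeing on the non-loop edges
inside the set. -/
lemma conn_restrictTo_transfer {S : Set V} {ω₁ ω₂ : Config E} {a b : V}
    (hagree : ∀ e x y, x ≠ y → x ∈ S → y ∈ S → ends e = s(x, y) → ω₁ e = ω₂ e)
    (hc : Conn ends (restrictTo ends ω₁ S) a b) : Conn ends (restrictTo ends ω₂ S) a b := by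
  have key : b ∈ {z | Conn ends (restrictTo ends ω₂ S) a z} := by
    refine mem_of_conn_of_closed (ends := ends) (ω := restrictTo ends ω₁ S) ?_ (conn_refl _ _ _) hc
    intro x hx y hxy
    obtain ⟨hne, e, he, hends⟩ := openGraph_adj.1 hxy
    unfold restrictTo at he
    by_cases hw : e ∈ within ends S
    · rw [if_pos hw] at he
      obtain ⟨u, hu, v, hv, huv⟩ := hw
      have hxS : x ∈ S ∧ y ∈ S := by
        rw [hends, Sym2.eq_iff] at huv
        rcases huv with ⟨rfl, rfl⟩ | ⟨rfl, rfl⟩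
        · exact ⟨hu, hv⟩
        · exact ⟨hv, hu⟩
      have he₂ : restrictTo ends ω₂ S e = true := by
        unfold restrictTo
        rw [if_pos ⟨x, hxS.1, y, hxS.2, hends⟩, ← hagree e x y hne hxS.1 hxS.2 hends]
        exact he
      exact conn_trans hx (conn_of_openAdj ⟨e, he₂, hends⟩)
    · rw [if_neg hw] at he; exact absurd he Bool.false_ne_true
  exact key

end Transfer

section Inj

variable {ends : E → Sym2 V} {p q r s d : V} {ω : Config E}

variable (h : IsEX ends p q r s d ω)
include h

/-- The `Y`-core of `Ψ₁ ω` consists of joined-or-linking vertices of `ω` and `W`-core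
vertices of `ω`. -/
lemma Kcore_psiOne_cases {x : V} (hx : x ∈ Kcore ends r s d (psiOne ends r s d ω)) :
    x ∈ joinedY ends r s d ω ∪ linkSetY ends r s d ω ∨ x ∈ Mcore ends r s d ω := by
  rcases K2_psiOne_subset h hx.1 with ((hT | hJ) | hL) | hM
  · simp only [Set.mem_insert_iff, Set.mem_singleton_iff] at hT
    rcases hT with rfl | rfl | rfl
    · exact (hx.2.1 rfl).elim
    · exact (hx.2.2.1 rfl).elim
    · exact (hx.2.2.2 rfl).elim
  · exact Or.inl (Or.inl hJ)
  · exact Or.inl (Or.inr hL)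
  · exact Or.inr hM

/-- A joined-or-linking vertex of `ω` lies in the `Y`-core of `Ψ₁ ω`. -/
lemma mem_Kcore_psiOne_of_mem_union {x : V}
    (hx : x ∈ joinedY ends r s d ω ∪ linkSetY ends r s d ω) :
    x ∈ Kcore ends r s d (psiOne ends r s d ω) :=
  ⟨mem_K2_psiOne_of_mem_union h hx, (mem_Kcore_of_mem_union hx).2.1,
    (mem_Kcore_of_mem_union hx).2.2.1, (mem_Kcore_of_mem_union hx).2.2.2⟩

/-- The joined-or-linking set of `ω` is closed under all-edge adjacency inside the `Y`-core
of `Ψ₁ ω`. -/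
lemma union_closed_psiOne :
    ∀ a ∈ joinedY ends r s d ω ∪ linkSetY ends r s d ω, ∀ b,
      (openGraph ends (allIn ends (Kcore ends r s d (psiOne ends r s d ω)))).Adj a b →
        b ∈ joinedY ends r s d ω ∪ linkSetY ends r s d ω := by
  intro a ha b hab
  obtain ⟨_, e, he, hends⟩ := openGraph_adj.1 hab
  unfold allIn at he
  by_cases hw : e ∈ within ends (Kcore ends r s d (psiOne ends r s d ω))
  · obtain ⟨u, hu, v, hv, huv⟩ := hw
    have hbK : b ∈ Kcore ends r s d (psiOne ends r s d ω) := by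
      rw [hends, Sym2.eq_iff] at huv
      rcases huv with ⟨_, rfl⟩ | ⟨_, rfl⟩
      · exact hv
      · exact hu
    rcases Kcore_psiOne_cases h hbK with hbJ | hbM
    · exact hbJ
    · exact (no_edge_core_core h (mem_Kcore_of_mem_union ha) hbM hends).elim
  · rw [if_neg hw] at he; exact absurd he Bool.false_ne_true

omit h in
/-- The joined-or-linking set of `ω` is closed under all-edge adjacency inside the `Y`-core
of `ω`. -/
lemma union_closed :
    ∀ a ∈ joinedY ends r s d ω ∪ linkSetY ends r s d ω, ∀ b,
      (openGraph ends (allIn ends (Kcore ends r s d ω))).Adj a b →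
        b ∈ joinedY ends r s d ω ∪ linkSetY ends r s d ω := by
  intro a ha b hab
  obtain ⟨_, e, he, hends⟩ := openGraph_adj.1 hab
  unfold allIn at he
  by_cases hw : e ∈ within ends (Kcore ends r s d ω)
  · obtain ⟨u, hu, v, hv, huv⟩ := hw
    have hbK : b ∈ Kcore ends r s d ω := by
      rw [hends, Sym2.eq_iff] at huv
      rcases huv with ⟨_, rfl⟩ | ⟨_, rfl⟩
      · exact hv
      · exact hu
    exact mem_union_of_edge ha hbK hends
  · rw [if_neg hw] at he; exact absurd he Bool.false_ne_true

/-- **The joined `Y`-blocks of `Ψ₁ ω` (read through the open edges at `d`) are those of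
`ω`.** -/
theorem joinedYOpen_psiOne :
    joinedYOpen ends r s d (psiOne ends r s d ω) = joinedY ends r s d ω := by
  ext x
  constructor
  · rintro ⟨y, ⟨hyK, e, hends, he⟩, hc⟩
    -- the generator `y` is a `Y`-core neighbour of `d` in `ω`
    have hyJ : y ∈ joinedY ends r s d ω := by
      rcases Kcore_psiOne_cases h hyK with hyJ | hyM
      · exact mem_joinedY_of_nbr (mem_Kcore_of_mem_union hyJ) hends
      · exfalso
        have hyW : y ∈ joinedW ends r s d ω := mem_joinedW_of_nbr hyM hends
        rw [psiOne_of_kept (mem_keptEdges_of_dW hyW hends), edge_Mcore_d h hyM (ends_swap hends)] at he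
        exact Bool.false_ne_true he
    have hx : x ∈ joinedY ends r s d ω ∪ linkSetY ends r s d ω :=
      mem_of_conn_of_closed (union_closed_psiOne h) (Or.inl hyJ) hc
    rcases hx with hx | hx
    · exact hx
    · -- a linking vertex in the all-edge component of a joined vertex inside the `Y`-core of
      -- `Ψ₁ ω` lies in `y`'s block of `ω`, hence is joined
      have hc' : Conn ends (allIn ends (Kcore ends r s d ω)) y x :=
        conn_allIn_transfer (T := joinedY ends r s d ω ∪ linkSetY ends r s d ω)
          (fun z hz => mem_Kcore_of_mem_union hz) (union_closed_psiOne h) (Or.inl hyJ) hc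
      exact mem_joinedY_of_conn hyJ hc'
  · rintro ⟨y, ⟨hyK, e, hends⟩, hc⟩
    have hyJ : y ∈ joinedY ends r s d ω := mem_joinedY_of_nbr hyK hends
    refine ⟨y, ⟨mem_Kcore_psiOne_of_mem_union h (Or.inl hyJ), e, hends, ?_⟩, ?_⟩
    · rw [psiOne_of_kept (mem_keptEdges_of_touches (Or.inl hyJ) (ends_swap hends))]
      exact edge_Kcore_d h hyK (ends_swap hends)
    · exact conn_allIn_transfer (T := joinedY ends r s d ω ∪ linkSetY ends r s d ω)
        (fun z hz => mem_Kcore_psiOne_of_mem_union h hz) union_closed (Or.inl hyJ) hc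

/-- A joined-or-linking vertex has the same block in `ω` and in `Ψ₁ ω`. -/
lemma blockIn_psiOne_eq {x : V} (hx : x ∈ joinedY ends r s d ω ∪ linkSetY ends r s d ω) :
    blockIn ends (Kcore ends r s d (psiOne ends r s d ω)) x = blockIn ends (Kcore ends r s d ω) x := by
  ext y
  constructor
  · intro hy
    exact conn_allIn_transfer (T := joinedY ends r s d ω ∪ linkSetY ends r s d ω)
      (fun z hz => mem_Kcore_of_mem_union hz) (union_closed_psiOne h) hx hy
  · intro hy
    exact conn_allIn_transfer (T := joinedY ends r s d ω ∪ linkSetY ends r s d ω)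
      (fun z hz => mem_Kcore_psiOne_of_mem_union h hz) union_closed hx hy

/-- `ω` and `Ψ₁ ω` agree on the non-loop edges inside a kept block with `r, s`. -/
lemma agree_on_block {x : V} (hx : x ∈ joinedY ends r s d ω ∪ linkSetY ends r s d ω)
    (hrs : ∀ e, ends e ≠ s(r, s)) :
    ∀ e a b, a ≠ b → a ∈ blockIn ends (Kcore ends r s d ω) x ∪ {r, s} →
      b ∈ blockIn ends (Kcore ends r s d ω) x ∪ {r, s} → ends e = s(a, b) →
        ω e = psiOne ends r s d ω e := by
  intro e a b hab ha hb hends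
  have hBU : blockIn ends (Kcore ends r s d ω) x ⊆ joinedY ends r s d ω ∪ linkSetY ends r s d ω :=
    fun z hz => mem_of_conn_of_closed union_closed hx hz
  rcases ha with ha | ha
  · rw [psiOne_of_kept (mem_keptEdges_of_touches (hBU ha) hends)]
  · rcases hb with hb | hb
    · rw [psiOne_of_kept (mem_keptEdges_of_touches (hBU hb) (ends_swap hends))]
    · exfalso
      simp only [Set.mem_insert_iff, Set.mem_singleton_iff] at ha hb
      rcases ha with rfl | rfl <;> rcases hb with rfl | rfl
      · exact hab rfl
      · exact hrs e hends
      · exact hrs e (ends_swap hends)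
      · exact hab rfl

/-- **The linking vertices of `Ψ₁ ω` are those of `ω`** (no `r–s` edge, no `W`-link in
`ω`). -/
theorem linkSetY_psiOne (hrs : ∀ e, ends e ≠ s(r, s))
    (hW : ¬ Conn ends (OneColourSwitch.compl ω) r s) :
    linkSetY ends r s d (psiOne ends r s d ω) = linkSetY ends r s d ω := by
  ext x
  constructor
  · rintro ⟨hxK, hc⟩
    rcases Kcore_psiOne_cases h hxK with hxJ | hxM
    · refine ⟨mem_Kcore_of_mem_union hxJ, ?_⟩
      rw [blockIn_psiOne_eq h hxJ] at hc
      exact conn_restrictTo_transfer (fun e a b hab ha hb hends =>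
        (agree_on_block h hxJ hrs e a b hab ha hb hends).symm) hc
    · -- a flipped `W`-block of `ω` linking in `Ψ₁ ω` would be `W`-linking in `ω`
      exfalso
      apply hW
      set B := blockIn ends (Kcore ends r s d (psiOne ends r s d ω)) x with hB
      have hBM : B ⊆ Mcore ends r s d ω := by
        intro y hy
        have key : y ∈ {z | z ∈ Mcore ends r s d ω} := by
          refine mem_of_conn_of_closed (ends := ends)
            (ω := allIn ends (Kcore ends r s d (psiOne ends r s d ω))) ?_ hxM hy
          intro a ha b hab
          obtain ⟨_, e, he, hends⟩ := openGraph_adj.1 hab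
          unfold allIn at he
          by_cases hw : e ∈ within ends (Kcore ends r s d (psiOne ends r s d ω))
          · obtain ⟨u, hu, v, hv, huv⟩ := hw
            have hbK : b ∈ Kcore ends r s d (psiOne ends r s d ω) := by
              rw [hends, Sym2.eq_iff] at huv
              rcases huv with ⟨_, rfl⟩ | ⟨_, rfl⟩
              · exact hv
              · exact hu
            rcases Kcore_psiOne_cases h hbK with hbJ | hbM
            · exact (no_edge_core_core h (mem_Kcore_of_mem_union hbJ) ha (ends_swap hends)).elim
            · exact hbM
          · rw [if_neg hw] at he; exact absurd he Bool.false_ne_true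
        exact key
      -- the restricted `Y`-connection of `Ψ₁ ω` inside `B ∪ {r, s}` is a `W`-connection of `ω`
      have key : s ∈ {z | Conn ends (OneColourSwitch.compl ω) r z} := by
        refine mem_of_conn_of_closed (ends := ends)
          (ω := restrictTo ends (psiOne ends r s d ω) (B ∪ {r, s})) ?_ (conn_refl _ _ _) hc
        intro a ha b hab
        obtain ⟨hne, e, he, hends⟩ := openGraph_adj.1 hab
        unfold restrictTo at he
        by_cases hw : e ∈ within ends (B ∪ {r, s})
        · rw [if_pos hw] at he
          obtain ⟨u, hu, v, hv, huv⟩ := hw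
          have habS : a ∈ B ∪ {r, s} ∧ b ∈ B ∪ {r, s} := by
            rw [hends, Sym2.eq_iff] at huv
            rcases huv with ⟨rfl, rfl⟩ | ⟨rfl, rfl⟩
            · exact ⟨hu, hv⟩
            · exact ⟨hv, hu⟩
          -- the edge is not kept: its ends are in the `W`-core or terminals, not `d`
          have hk : e ∉ keptEdges ends r s d ω := by
            have hnot : ∀ z ∈ B ∪ {r, s}, z ∉ joinedY ends r s d ω ∪ linkSetY ends r s d ω ∧ z ≠ d := by
              rintro z (hz | hz)
              · exact ⟨Mcore_not_mem_union h.done (hBM hz), (hBM hz).2.2.2⟩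
              · simp only [Set.mem_insert_iff, Set.mem_singleton_iff] at hz
                rcases hz with rfl | rfl
                · exact ⟨term_not_mem_union (Or.inl rfl), fun hd => h.hr hd.symm⟩
                · exact ⟨term_not_mem_union (Or.inr rfl), fun hd => h.hs hd.symm⟩
            exact not_kept hends (hnot a habS.1).1 (hnot b habS.2).1
              (fun had => ((hnot a habS.1).2 had).elim) (fun hbd => ((hnot b habS.2).2 hbd).elim)
          rw [psiOne_of_not_kept hk] at he
          have hω : ω e = false := by
            cases hω : ω e
            · rfl
            · rw [hω] at he; exact absurd he (by decide)
          refine conn_trans ha (conn_of_openAdj ⟨e, ?_, hends⟩)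
          simp [OneColourSwitch.compl, hω]
        · rw [if_neg hw] at he; exact absurd he Bool.false_ne_true
      exact key
  · rintro ⟨hxK, hc⟩
    have hxL : x ∈ joinedY ends r s d ω ∪ linkSetY ends r s d ω := Or.inr ⟨hxK, hc⟩
    refine ⟨mem_Kcore_psiOne_of_mem_union h hxL, ?_⟩
    rw [blockIn_psiOne_eq h hxL]
    exact conn_restrictTo_transfer (agree_on_block h hxL hrs) hc

/-- **The closed non-loop edges of `Ψ₁ ω` at `d` are the edges of `d` into the joined
`W`-blocks of `ω`.** -/
theorem psiOne_d_closed_iff {e : E} :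
    (∃ y, y ≠ d ∧ ends e = s(d, y) ∧ psiOne ends r s d ω e = false) ↔
      ∃ y ∈ joinedW ends r s d ω, ends e = s(d, y) := by
  constructor
  · rintro ⟨y, hyd, hends, he⟩
    refine ⟨y, ?_, hends⟩
    rcases vertex_cases (ends := ends) (r := r) (s := s) (d := d) (ω := ω) y with
      hy | hy | hy | hyK | hyM | hyO
    · exact (no_edge_d_term h (Or.inl hy) hends).elim
    · exact (no_edge_d_term h (Or.inr hy) hends).elim
    · exact (hyd hy).elim
    · exfalso
      have hyJ : y ∈ joinedY ends r s d ω := mem_joinedY_of_nbr hyK hends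
      rw [psiOne_of_kept (mem_keptEdges_of_touches (Or.inl hyJ) (ends_swap hends)),
        edge_Kcore_d h hyK (ends_swap hends)] at he
      exact absurd he (by decide)
    · exact mem_joinedW_of_nbr hyM hends
    · exact (no_edge_d_out h hyO hends).elim
  · rintro ⟨y, hyW, hends⟩
    refine ⟨y, (joinedW_subset_Mcore hyW).2.2.2, hends, ?_⟩
    rw [psiOne_of_kept (mem_keptEdges_of_dW hyW hends)]
    exact edge_Mcore_d h (joinedW_subset_Mcore hyW) (ends_swap hends)

/-- **The read-as-kept edges of the image are the kept edges of the source.** -/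
theorem recEdges_psiOne (hrs : ∀ e, ends e ≠ s(r, s))
    (hW : ¬ Conn ends (OneColourSwitch.compl ω) r s) :
    recEdges ends r s d (psiOne ends r s d ω) = keptEdges ends r s d ω := by
  unfold recEdges keptEdges
  rw [joinedYOpen_psiOne h, linkSetY_psiOne h hrs hW]
  congr 1
  ext e
  exact psiOne_d_closed_iff h

/-- **The recovery map inverts `Ψ₁`.** -/
theorem recPsi_psiOne (hrs : ∀ e, ends e ≠ s(r, s))
    (hW : ¬ Conn ends (OneColourSwitch.compl ω) r s) :
    recPsi ends r s d (psiOne ends r s d ω) = ω := by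
  funext e
  unfold recPsi
  rw [recEdges_psiOne h hrs hW]
  by_cases hk : e ∈ keptEdges ends r s d ω
  · rw [if_pos hk, psiOne_of_kept hk]
  · rw [if_neg hk, psiOne_of_not_kept hk, Bool.not_not]

end Inj

section InjOn

variable {ends : E → Sym2 V} {p q r s d : V}

/-- **`Ψ₁` is injective on the doubly-reached colourings without a `W`-link.** -/
theorem psiOne_injOn (hrs : ∀ e, ends e ≠ s(r, s)) :
    Set.InjOn (psiOne ends r s d)
      {ω | IsEX ends p q r s d ω ∧ ¬ Conn ends (OneColourSwitch.compl ω) r s} := by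
  intro ω₁ hω₁ ω₂ hω₂ heq
  rw [← recPsi_psiOne hω₁.1 hrs hω₁.2, ← recPsi_psiOne hω₂.1 hrs hω₂.2, heq]

end InjOn

end NoPocket

end Summit.Ventures.PercRepro2
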